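import Mathlib
import Literature.Analysis.FluidPDE.NSGalerkinTrajectory

/-!
# Crux `WazewskiBlock.UniformWorkFloorTrap` (stmt-AnomalousDissipation-10353), line `Sketch`:
# stub `stub_workFallRate` — the work functional falls no faster than the stress budget

Along a global Galerkin trajectory `U` of order `N` (`Torus.IsGalerkinTrajectory ν f N U`) driven by
a Galerkin-mode force `f` of order `m ≤ N`, the work `W(τ) = ∫⟪f, U τ⟫` obeys, by the tested Galerkin
identity with the ADMISSIBLE test field `a := f` (`IsGalerkinMode.mono`),
`W(t) - W(s) = ∫ₛᵗ r(τ) dτ` with the rate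
`r(τ) = ∫⟪U τ, (U τ·∇)f⟫ + ν∫⟪U τ, Δf⟫ + ∫‖f‖²`.
If `-D` (`D ≥ 0`) bounds that rate from below on the Galerkin modes of the energy ball
`{kineticEnergy ≤ E}` and the orbit's energy is `≤ E` on `[s, t]`, then `W(t) - W(s) ≥ -D (t - s)`:
the `ν`-, `N`-free fall rate by which the crux's pointwise work floor is certified from samples.

* `stub_workFallRate` — the registered stub, proved (no hypotheses beyond the registered signature).

Proof: split the space integral of the tested identity's integrand on `[s, t]` (all fields smooth, so
every term is integrable; `⟪f, f⟫ = ‖f‖²`), bound the rate pointwise on `[s, t]` by `-D`, and integrate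
(`intervalIntegral.integral_mono_on` against the constant; a non-interval-integrable rate has integral
`0 ≥ -D (t - s)`, so no time-continuity of the rate is needed).
-/

noncomputable section

-- `Summit.<Summit>.<Problem>` is the tree's mandated summit-side namespace (CONVENTIONS §2); deliberate duplicate.
set_option linter.dupNamespace false

namespace Summit.AnomalousDissipation.AnomalousDissipation.Theorems.UniformWorkFloorTrap.Sketch

open scoped InnerProductSpace
open MeasureTheory Filter Set UnitAddTorus
open Literature.Analysis.FunctionSpaces Literature.Analysis.FunctionSpaces.Torus
open Literature.Analysis.FluidPDE

/-- **Integrating a lower bound without integrability.** If `-D ≤ r τ` on `[s, t]` with `D ≥ 0` and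
`s ≤ t`, then `-D (t - s) ≤ ∫ₛᵗ r`: by monotonicity of the interval integral when `r` is interval
integrable, and because the (junk) integral is `0 ≥ -D (t - s)` otherwise. [folklore] -/
private theorem neg_mul_le_intervalIntegral_of_forall_le {r : ℝ → ℝ} {s t D : ℝ} (hD : 0 ≤ D)
    (hst : s ≤ t) (h : ∀ τ ∈ Set.Icc s t, -D ≤ r τ) : -(D * (t - s)) ≤ ∫ τ in s..t, r τ := by
  by_cases hint : IntervalIntegrable r volume s t
  · have h1 : ∫ _ in s..t, (-D) ≤ ∫ τ in s..t, r τ :=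
      intervalIntegral.integral_mono_on hst intervalIntegrable_const hint h
    rw [intervalIntegral.integral_const, smul_eq_mul] at h1
    linarith
  · rw [intervalIntegral.integral_undef hint]
    nlinarith [mul_nonneg hD (sub_nonneg.2 hst)]

/-- **Work fall rate.** Along a global Galerkin trajectory `U` of order `N ≥ m` driven by a
Galerkin-mode force `f` of order `m`, whose energy stays `≤ E` on `[s, t]` (`0 ≤ s ≤ t`): if `-D`
(`D ≥ 0`) bounds from below the instantaneous work rate `∫⟪V,(V·∇)f⟫ + ν∫⟪V,Δf⟫ + ∫‖f‖²` on the
Galerkin modes `V` of order `N` in the energy ball `{kineticEnergy ≤ E}`, then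
`(f, U t) - (f, U s) ≥ -D (t - s)`. Proof: the tested Galerkin identity with the admissible test
field `a := f` (`IsGalerkinMode.mono`), splitting of the space integral on `[s, t]` (all fields
smooth), the pointwise rate bound at the Galerkin-mode slices `U τ`, and
`neg_mul_le_intervalIntegral_of_forall_le`. [folklore] -/
theorem stub_workFallRate :
    ∀ (ν : ℝ) (m N : ℕ) (f : UnitAddTorus (Fin 3) → EuclideanSpace ℝ (Fin 3)) (E D : ℝ)
      (U : ℝ → UnitAddTorus (Fin 3) → EuclideanSpace ℝ (Fin 3)) (s t : ℝ),
      IsGalerkinMode m f → m ≤ N → Torus.IsGalerkinTrajectory ν f N U → 0 ≤ D → 0 ≤ s → s ≤ t →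
      (∀ τ ∈ Set.Icc s t, kineticEnergy (U τ) ≤ E) →
      (∀ V : UnitAddTorus (Fin 3) → EuclideanSpace ℝ (Fin 3), IsGalerkinMode N V →
        kineticEnergy V ≤ E →
        -D ≤ (∫ x, ⟪V x, convect V f x⟫_ℝ) + ν * (∫ x, ⟪V x, laplacian f x⟫_ℝ) + ∫ x, ‖f x‖ ^ 2) →
      -(D * (t - s)) ≤ (∫ x, ⟪f x, U t x⟫_ℝ) - ∫ x, ⟪f x, U s x⟫_ℝ := by
  intro ν m N f E D U s t hf hmN hU hD hs hst hE hrate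
  -- the tested Galerkin identity with the admissible test field `a := f`
  have hgal := hU.galerkin f (hf.mono hmN) s t hs hst
  have hcomm : ∀ τ : ℝ, (∫ x, ⟪f x, U τ x⟫_ℝ) = ∫ x, ⟪U τ x, f x⟫_ℝ := fun τ =>
    integral_congr_ae (ae_of_all _ fun x => real_inner_comm _ _)
  rw [hcomm t, hcomm s, hgal]
  refine neg_mul_le_intervalIntegral_of_forall_le hD hst fun τ hτ => ?_
  -- pointwise on `[s, t]`: split the space integral and apply the rate bound at the slice `U τ`
  have hτ0 : 0 ≤ τ := hs.trans hτ.1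
  have hUτ : IsSmooth (U τ) := hU.isSmooth hτ0
  have iA : Integrable (fun x => ⟪U τ x, convect (U τ) f x⟫_ℝ) volume :=
    (hUτ.inner (hUτ.convect hf.isSmooth)).integrable
  have iB : Integrable (fun x => ν * ⟪U τ x, laplacian f x⟫_ℝ) volume :=
    (hUτ.inner hf.isSmooth.laplacian).integrable.const_mul ν
  have iAB : Integrable
      (fun x => ⟪U τ x, convect (U τ) f x⟫_ℝ + ν * ⟪U τ x, laplacian f x⟫_ℝ) volume := iA.add iB
  have iC : Integrable (fun x => ⟪f x, f x⟫_ℝ) volume := (hf.isSmooth.inner hf.isSmooth).integrable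
  have h := hrate (U τ) (hU.isGalerkinMode τ hτ0) (hE τ hτ)
  rw [integral_add iAB iC, integral_add iA iB, integral_const_mul]
  simp_rw [real_inner_self_eq_norm_sq]
  exact h

end Summit.AnomalousDissipation.AnomalousDissipation.Theorems.UniformWorkFloorTrap.Sketch

end
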